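import Mathlib

/-!
# Block splitting of high-degree vertices into pieces of leg-degree `≤ L` — line «sfm-bl» (PROOF-SFM-BL §0)

FRONTIER F-N1c; nothing here bears on P vs NP.

A concrete, computable FREE SPLITTING (cf. `SfmBlLegModel.cutCertified_of_legs`, which allows ANY assignment
of legs to pieces of the right owner).  Legs `l : Λ` sit at vertices `vert l : V`; `idx : Λ → ℕ` is any
injective numbering.  The RANK of a leg in its fibre is `#{l' : vert l' = vert l, idx l' < idx l}`; the leg is
put into BLOCK `rank / L` of its vertex, and vertex `v` carries `max 1 ⌈D_v/L⌉` blocks (`D_v = #fibre`).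
Proved (definition-free; the pieces are then `Σ v, Fin (max 1 ((D_v + L - 1) / L))` with owner `Sigma.fst`):
* `fiberRank_lt_card`: rank `< D_v`;  `fiberRank_lt_of_idx_lt` / `fiberRank_injOn`: rank is injective on a fibre;
* `fiberRank_div_lt`: the block index is `< max 1 ((D_v + L - 1) / L)` (so `src l := ⟨vert l, rank l / L⟩` typechecks);
* `card_block_le`: every block holds at most `L` legs (hypotheses `hrow`/`hcol`/`hdeg ≤ L` of Prop. 7);
* `sum_blocks_le`: the number of pieces is `Σ_v max 1 ⌈D_v/L⌉ ≤ |V| + |Λ|/L` (so `N ≤ (2n+1) + 6m/L` for the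
  two sides of a 3-local instance with `3m` legs per side).
-/

namespace Summit.PneNP.PneNP.Theorems.SfmBl

open Finset BigOperators

variable {Λ V : Type} [Fintype Λ] [DecidableEq V]

/-- The rank of a leg in its fibre is `<` the fibre size. -/
theorem fiberRank_lt_card (vert : Λ → V) (idx : Λ → ℕ) (l : Λ) :
    (univ.filter (fun l' => vert l' = vert l ∧ idx l' < idx l)).card
      < (univ.filter (fun l' => vert l' = vert l)).card := by
  apply Finset.card_lt_card
  rw [Finset.ssubset_iff_of_subset]
  · exact ⟨l, by simp, by simp⟩
  · intro l' hl'
    simp only [Finset.mem_filter, Finset.mem_univ, true_and] at hl' ⊢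
    exact hl'.1

/-- Rank is strictly monotone in `idx` along a fibre. -/
theorem fiberRank_lt_of_idx_lt (vert : Λ → V) (idx : Λ → ℕ) {l₁ l₂ : Λ} (hv : vert l₁ = vert l₂)
    (h : idx l₁ < idx l₂) :
    (univ.filter (fun l' => vert l' = vert l₁ ∧ idx l' < idx l₁)).card
      < (univ.filter (fun l' => vert l' = vert l₂ ∧ idx l' < idx l₂)).card := by
  apply Finset.card_lt_card
  rw [Finset.ssubset_iff_of_subset]
  · refine ⟨l₁, ?_, ?_⟩
    · simp [hv, h]
    · simp
  · intro l' hl'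
    simp only [Finset.mem_filter, Finset.mem_univ, true_and] at hl' ⊢
    exact ⟨hl'.1.trans hv, hl'.2.trans h⟩

/-- Rank is injective on each fibre (for an injective numbering `idx`). -/
theorem fiberRank_injOn (vert : Λ → V) (idx : Λ → ℕ) (hidx : Function.Injective idx) (v : V) :
    Set.InjOn (fun l => (univ.filter (fun l' => vert l' = vert l ∧ idx l' < idx l)).card)
      {l | vert l = v} := by
  intro l₁ h₁ l₂ h₂ heq
  simp only [Set.mem_setOf_eq] at h₁ h₂
  by_contra hne
  have hne' : idx l₁ ≠ idx l₂ := fun h => hne (hidx h)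
  rcases lt_or_gt_of_ne hne' with hlt | hgt
  · exact absurd heq (fiberRank_lt_of_idx_lt vert idx (h₁.trans h₂.symm) hlt).ne
  · exact absurd heq (fiberRank_lt_of_idx_lt vert idx (h₂.trans h₁.symm) hgt).ne'

/-- The block index `rank / L` is `< max 1 ⌈D_v/L⌉` (with `⌈D/L⌉ = (D + L - 1) / L`). -/
theorem fiberRank_div_lt (vert : Λ → V) (idx : Λ → ℕ) {L : ℕ} (hL : 0 < L) (l : Λ) :
    (univ.filter (fun l' => vert l' = vert l ∧ idx l' < idx l)).card / L
      < max 1 (((univ.filter (fun l' => vert l' = vert l)).card + L - 1) / L) := by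
  have hr := fiberRank_lt_card vert idx l
  set D := (univ.filter (fun l' => vert l' = vert l)).card
  refine lt_of_lt_of_le ?_ (le_max_right _ _)
  rw [Nat.div_lt_iff_lt_mul hL]
  have h1 : D ≤ (D + L - 1) / L * L := by
    have := Nat.lt_div_mul_add (a := D + L - 1) hL
    omega
  omega

/-- Every block holds at most `L` legs. -/
theorem card_block_le (vert : Λ → V) (idx : Λ → ℕ) (hidx : Function.Injective idx) {L : ℕ}
    (hL : 0 < L) (v : V) (t : ℕ) :
    (univ.filter (fun l => vert l = v ∧
      (univ.filter (fun l' => vert l' = vert l ∧ idx l' < idx l)).card / L = t)).card ≤ L := by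
  set rank : Λ → ℕ := fun l => (univ.filter (fun l' => vert l' = vert l ∧ idx l' < idx l)).card
    with hrank
  have hmaps : ∀ l ∈ univ.filter (fun l => vert l = v ∧ rank l / L = t),
      rank l ∈ Finset.Ico (t * L) (t * L + L) := by
    intro l hl
    simp only [Finset.mem_filter, Finset.mem_univ, true_and] at hl
    rw [Finset.mem_Ico]
    have h3 : t * L ≤ rank l := by
      have := Nat.div_mul_le_self (rank l) L
      rw [hl.2] at this; exact this
    have h4 : rank l < t * L + L := by
      have := Nat.lt_div_mul_add (a := rank l) hL
      rw [hl.2] at this; exact this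
    exact ⟨h3, h4⟩
  have hinj : Set.InjOn rank (univ.filter (fun l => vert l = v ∧ rank l / L = t) : Finset Λ) := by
    intro l₁ h₁ l₂ h₂ heq
    simp only [Finset.coe_filter, Finset.mem_univ, true_and, Set.mem_setOf_eq] at h₁ h₂
    exact fiberRank_injOn vert idx hidx v h₁.1 h₂.1 heq
  calc (univ.filter (fun l => vert l = v ∧ rank l / L = t)).card
      ≤ (Finset.Ico (t * L) (t * L + L)).card := Finset.card_le_card_of_injOn rank hmaps hinj
    _ = L := by simp

/-- The number of pieces: `Σ_v max 1 ⌈D_v/L⌉ ≤ |V| + |Λ| / L`. -/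
theorem sum_blocks_le [Fintype V] (vert : Λ → V) {L : ℕ} (hL : 0 < L) :
    ∑ v, max 1 (((univ.filter (fun l' => vert l' = v)).card + L - 1) / L)
      ≤ Fintype.card V + Fintype.card Λ / L := by
  have h1 : ∀ v, max 1 (((univ.filter (fun l' => vert l' = v)).card + L - 1) / L)
      ≤ 1 + (univ.filter (fun l' => vert l' = v)).card / L := by
    intro v
    set D := (univ.filter (fun l' => vert l' = v)).card
    refine max_le (Nat.le_add_right 1 _) ?_
    calc (D + L - 1) / L ≤ (D + L) / L := Nat.div_le_div_right (by omega)
      _ = D / L + 1 := Nat.add_div_right D hL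
      _ = 1 + D / L := by ring
  calc ∑ v, max 1 (((univ.filter (fun l' => vert l' = v)).card + L - 1) / L)
      ≤ ∑ v, (1 + (univ.filter (fun l' => vert l' = v)).card / L) := Finset.sum_le_sum fun v _ => h1 v
    _ = Fintype.card V + ∑ v, (univ.filter (fun l' => vert l' = v)).card / L := by
        rw [Finset.sum_add_distrib]; simp
    _ ≤ Fintype.card V + (∑ v, (univ.filter (fun l' => vert l' = v)).card) / L := by
        gcongr
        rw [Nat.le_div_iff_mul_le hL, Finset.sum_mul]
        exact Finset.sum_le_sum fun v _ => Nat.div_mul_le_self _ L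
    _ = Fintype.card V + Fintype.card Λ / L := by
        congr 1
        rw [← Finset.card_univ, Finset.card_eq_sum_card_fiberwise (f := vert) (fun l _ => Finset.mem_univ (vert l))]

end Summit.PneNP.PneNP.Theorems.SfmBl
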